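import Summits.QuantumFields.YangMills.Theorems.BalabanStepParabolic.Negative.OrbitRecursion

/-!
# `BalabanStepParabolic` — negative-side support IV: everything but continuity is junk-inhabited (every `M ≥ 2`)

Support file for crux `stmt-QuantumFields-9684` (`ParabolicTrajectory.BalabanStepParabolic`), extracted from the
standing disprover's work file `Cruxes/BalabanStepParabolic/Disproof.lean` §A (cycle 2). Tree objects only.

`PreStep G r M`: the structure `BalabanBanachStep G r M` with the single field `continuousOn_expect` (4c) removed
(every other field verbatim; `toPreStep` is the forgetful map). `preStepJunk`, `preStep_nonempty`: `PreStep G r M`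
is inhabited for EVERY `G`, `r`, `M ≥ 2` — chart `ℝ × ℝ`, exactly parabolic flow `g ↦ g + (log M) g³`, halving
fibre map, Wilson embedding `yW g = (1, g)`, `betaOf g = 1/g²`, and the functional `expectJ` built by `orbitRec`
(`expectJ_step`: (4a) identically; `expectJ_orbit`, `expectJ_wilson`: (4b) by decoding the depth `k` and the bare
coupling `g` from the fibre coordinate `((1/2)^k, (1/2)^k g)`). Hence ALL the content of the crux is in (4c); (4a)
and (4b) are jointly consistent without it, for even and odd `M` alike.
-/

namespace Summit.QuantumFields.YangMills.Theorems.BalabanStepParabolic.Negative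

open scoped SchwartzMap
open MeasureTheory Filter Topology
open Literature.MathematicalPhysics.QuantumFieldTheory Literature.MathematicalPhysics.AQFT
open Literature.MathematicalPhysics.QuantumLattice

noncomputable section

/-! ### §A  The junk chart `ℝ × ℝ` and the inhabitant of everything but (4c) -/

section Junk

variable {G : Type} [Group G] [TopologicalSpace G] [IsTopologicalGroup G] [CompactSpace G]
  [MeasurableSpace G] [BorelSpace G] (r : LatticeRep G) (M : ℕ)

/-- Junk coupling flow `g ↦ g + (log M) g³` (exactly parabolic, `b₀ = 1`). -/
def φJ (g : ℝ) : ℝ := g + Real.log M * g ^ 3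

/-- Junk step on the chart `ℝ × (ℝ × ℝ)`: parabolic in `g`, halving in the fibre. -/
def FJ (p : ℝ × (ℝ × ℝ)) : ℝ × (ℝ × ℝ) := (φJ M p.1, (1 / 2 : ℝ) • p.2)

/-- The orbit of the junk Wilson point `(g, (1, g))`: the fibre coordinate `((1/2)^k, (1/2)^k g)`
ENCODES the depth `k` and the bare coupling `g`. [folklore] -/
theorem FJ_iterate (k : ℕ) (g : ℝ) :
    (FJ M)^[k] (g, ((1 : ℝ), g)) = ((φJ M)^[k] g, ((1 / 2 : ℝ) ^ k, (1 / 2 : ℝ) ^ k * g)) := by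
  induction k with
  | zero => simp
  | succ k ih =>
    rw [Function.iterate_succ_apply', ih, Function.iterate_succ_apply']
    simp only [FJ, Prod.smul_mk, smul_eq_mul, Prod.mk.injEq, true_and]
    constructor <;> ring

/-- `k ↦ (1/2)^k` is injective. [folklore] -/
theorem half_pow_injective : Function.Injective fun k : ℕ => (1 / 2 : ℝ) ^ k :=
  pow_right_injective₀ (by norm_num) (by norm_num)

open Classical in
/-- The germ of the junk realisation functional: decode `(k, g)` from the fibre coordinate and
return the genuine Wilson data it must carry (`0` elsewhere). -/
def germ (n : ℕ) (σ : Fin n → YMSpecies G) (q : ℝ × (ℝ × ℝ)) (S₀ : ℕ)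
    (h : Fin n → 𝓢(EuclideanSpace ℝ (Fin 4), ℝ)) : ℝ :=
  if hq : ∃ k : ℕ, q.2.1 = (1 / 2 : ℝ) ^ k then
    if Odd (M ^ Nat.find hq * S₀) ∧ q.2.2 * 2 ^ Nat.find hq ∈ Set.Ioc (0 : ℝ) 1 then
      wilsonCentredSchwinger r.ρ (1 / (q.2.2 * 2 ^ Nat.find hq) ^ 2)
        ((M ^ Nat.find hq * S₀ - 1) / 2) (fun _ => 1) n σ
        (fun i => (blockDilate M)^[Nat.find hq] (h i))
    else 0
  else 0

open Classical in
/-- The germ read at an orbit point of a junk Wilson point. [folklore] -/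
theorem germ_orbit (n : ℕ) (σ : Fin n → YMSpecies G) {g : ℝ} (hg : g ∈ Set.Ioc (0 : ℝ) 1)
    (k S₀ : ℕ) (h : Fin n → 𝓢(EuclideanSpace ℝ (Fin 4), ℝ)) :
    germ r M n σ ((FJ M)^[k] (g, ((1 : ℝ), g))) S₀ h =
      if Odd (M ^ k * S₀) then
        wilsonCentredSchwinger r.ρ (1 / g ^ 2) ((M ^ k * S₀ - 1) / 2) (fun _ => 1) n σ
          (fun i => (blockDilate M)^[k] (h i))
      else 0 := by
  rw [FJ_iterate]
  have hq : ∃ k' : ℕ, ((1 / 2 : ℝ) ^ k) = (1 / 2 : ℝ) ^ k' := ⟨k, rfl⟩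
  unfold germ
  simp only
  rw [dif_pos hq]
  have hfind : Nat.find hq = k := by
    rw [Nat.find_eq_iff]
    refine ⟨rfl, fun j hj heq => ?_⟩
    exact (Nat.ne_of_lt hj) (half_pow_injective heq).symm
  rw [hfind]
  have hg' : (1 / 2 : ℝ) ^ k * g * 2 ^ k = g := by
    rw [mul_comm, ← mul_assoc, ← mul_pow]; norm_num
  rw [hg']
  by_cases hodd : Odd (M ^ k * S₀)
  · simp [hodd, hg]
  · simp [hodd]

variable (hM : 2 ≤ M)

/-- The junk realisation functional (F1 recursion over the junk germ). -/
def expectJ (n : ℕ) (σ : Fin n → YMSpecies G) (p : ℝ × (ℝ × ℝ)) (S : ℕ)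
    (f : Fin n → 𝓢(EuclideanSpace ℝ (Fin 4), ℝ)) : ℝ :=
  orbitRec M (FJ M) (contractTuple M) (germ r M n σ) hM p S f

/-- (4a) holds identically for the junk functional. [folklore] -/
theorem expectJ_step (n : ℕ) (σ : Fin n → YMSpecies G) (p : ℝ × (ℝ × ℝ)) (S : ℕ)
    (f : Fin n → 𝓢(EuclideanSpace ℝ (Fin 4), ℝ)) :
    expectJ r M hM n σ (FJ M p) S f =
      expectJ r M hM n σ p (M * S) (fun i => blockDilate M (f i)) := by
  have hM0 : M ≠ 0 := by omega
  by_cases hS : S = 0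
  · subst hS
    unfold expectJ
    rw [mul_zero, orbitRec_of_not _ _ _ hM _ 0 _ (by simp), orbitRec_of_not _ _ _ hM _ 0 _ (by simp)]
    have h0 : ∀ (q : ℝ × (ℝ × ℝ)) (h : Fin n → 𝓢(EuclideanSpace ℝ (Fin 4), ℝ)),
        germ r M n σ q 0 h = 0 := by
      intro q h
      unfold germ
      split_ifs with hq hc
      · exact absurd hc.1 (by simp)
      · rfl
      · rfl
    rw [h0, h0]
  · unfold expectJ
    rw [orbitRec_mul _ _ _ hM p hS]
    congr 1
    funext i
    exact (blockContract_blockDilate hM0 (f i)).symm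

/-- **Orbit values of the junk functional**: at depth `k` of the orbit of `(g, (1, g))`, on the
torus `S'`, it returns the genuine Wilson data on the torus `M^k S'` (when odd) at `β = 1/g²`
with `k`-fold dilated test functions. [folklore] -/
theorem expectJ_orbit (n : ℕ) (σ : Fin n → YMSpecies G) {g : ℝ} (hg : g ∈ Set.Ioc (0 : ℝ) 1)
    (S' k : ℕ) (h : Fin n → 𝓢(EuclideanSpace ℝ (Fin 4), ℝ)) :
    expectJ r M hM n σ ((FJ M)^[k] (g, ((1 : ℝ), g))) S' h =
      if Odd (M ^ k * S') then
        wilsonCentredSchwinger r.ρ (1 / g ^ 2) ((M ^ k * S' - 1) / 2) (fun _ => 1) n σ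
          (fun i => (blockDilate M)^[k] (h i))
      else 0 := by
  have hM0 : M ≠ 0 := by omega
  induction S' using Nat.strong_induction_on generalizing k h with
  | _ S' ih =>
    by_cases hdiv : S' ≠ 0 ∧ M ∣ S'
    · obtain ⟨S'', rfl⟩ := hdiv.2
      have hS'' : S'' ≠ 0 := by rintro rfl; exact hdiv.1 (by simp)
      have hlt : S'' < M * S'' := by
        have : 1 * S'' < M * S'' := Nat.mul_lt_mul_of_pos_right (by omega) (Nat.pos_of_ne_zero hS'')
        simpa using this
      unfold expectJ
      rw [orbitRec_mul _ _ _ hM _ hS'', ← Function.iterate_succ_apply' (FJ M) k]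
      have := ih S'' hlt (k + 1) (contractTuple M h)
      unfold expectJ at this
      rw [this]
      have hpow : M ^ (k + 1) * S'' = M ^ k * (M * S'') := by ring
      have hfun : (fun i => (blockDilate M)^[k + 1] (contractTuple M h i)) =
          fun i => (blockDilate M)^[k] (h i) := by
        funext i
        rw [Function.iterate_succ_apply]
        simp [contractTuple, blockDilate_blockContract hM0]
      rw [hpow, hfun]
    · unfold expectJ
      rw [orbitRec_of_not _ _ _ hM _ _ _ hdiv]
      exact germ_orbit r M n σ hg k S' h

/-- (4b) for the junk functional: at the junk Wilson point `(g, (1, g))` on the odd torus `2L+1`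
it IS Wilson's centred `n`-point function at `β = 1/g²` (every `M ≥ 2`). [folklore] -/
theorem expectJ_wilson (n : ℕ) (σ : Fin n → YMSpecies G) {g : ℝ} (hg : g ∈ Set.Ioc (0 : ℝ) 1)
    (L : ℕ) (f : Fin n → 𝓢(EuclideanSpace ℝ (Fin 4), ℝ)) :
    expectJ r M hM n σ (g, ((1 : ℝ), g)) (2 * L + 1) f =
      wilsonCentredSchwinger r.ρ (1 / g ^ 2) L (fun _ => 1) n σ f := by
  have h := expectJ_orbit r M hM n σ hg (2 * L + 1) 0 f
  simp only [Function.iterate_zero, id_eq, pow_zero, one_mul] at h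
  rw [h, if_pos ⟨L, rfl⟩]
  congr 1
  omega

end Junk

/-! ### §A (continued)  `PreStep` = `BalabanBanachStep` minus (4c), inhabited for every `M ≥ 2` -/

/-- **`BalabanBanachStep` with the single field `continuousOn_expect` (4c) removed** — every
other field verbatim (chart, parabolic hypothesis block, basin, Wilson embedding, `betaOf`,
normalisations, realisation functional with (4a) exact covariance and (4b) Wilson
identification). -/
structure PreStep (G : Type) [Group G] [TopologicalSpace G] [IsTopologicalGroup G]
    [CompactSpace G] [MeasurableSpace G] [BorelSpace G] (r : LatticeRep G) (M : ℕ) where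
  E : Type
  [instNormedAddCommGroup : NormedAddCommGroup E]
  [instNormedSpace : NormedSpace ℝ E]
  [instCompleteSpace : CompleteSpace E]
  φ : ℝ → E → ℝ
  Ψ : ℝ → E → E
  A : E →L[ℝ] E
  b : ℝ
  θ : ℝ
  C : ℝ
  δ : ℝ
  -- the hypothesis block of `ParabolicCentreCurve`, verbatim
  b_pos : 0 < b
  θ_nonneg : 0 ≤ θ
  θ_lt_one : θ < 1
  C_pos : 0 < C
  δ_pos : 0 < δ
  norm_A_le : ‖A‖ ≤ θ
  remainder : ∀ g : ℝ, ∀ y : E, |g| ≤ δ → ‖y‖ ≤ δ →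
    |φ g y - (g + b * g ^ 3)| ≤ C * (g ^ 4 + |g| ^ 3 * ‖y‖) ∧
      ‖Ψ g y - A y‖ ≤ C * (g ^ 2 + ‖y‖ ^ 2)
  lipschitz_fibre : ∀ g : ℝ, ∀ y y' : E, |g| ≤ δ → ‖y‖ ≤ δ → ‖y'‖ ≤ δ →
    |φ g y - φ g y'| ≤ C * |g| ^ 3 * ‖y - y'‖ ∧
      ‖Ψ g y - Ψ g y' - A (y - y')‖ ≤ C * (|g| + ‖y‖ + ‖y'‖) * ‖y - y'‖
  lipschitz_base : ∀ g g' : ℝ, ∀ y : E, |g| ≤ δ → |g'| ≤ δ → ‖y‖ ≤ δ →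
    |φ g y - φ g' y - (g - g') - b * (g ^ 3 - g' ^ 3)| ≤
        C * (max |g| |g'|) ^ 2 * (max |g| |g'| + ‖y‖) * |g - g'| ∧
      ‖Ψ g y - Ψ g' y‖ ≤ C * (|g| + |g'| + ‖y‖) * |g - g'|
  b₀ : ℝ
  b_eq : b = b₀ * Real.log M
  R : ℝ
  δ_le_R : δ ≤ R
  θ' : ℝ
  θ'_nonneg : 0 ≤ θ'
  θ'_lt_one : θ' < 1
  contraction : ∀ g : ℝ, ∀ y y' : E, |g| ≤ δ → ‖y‖ ≤ R → ‖y'‖ ≤ R →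
    ‖Ψ g y - Ψ g y'‖ ≤ θ' * ‖y - y'‖
  remainder_basin : ∀ g : ℝ, ∀ y : E, |g| ≤ δ → ‖y‖ ≤ R →
    |φ g y - (g + b * g ^ 3)| ≤ C * (g ^ 4 + |g| ^ 3 * ‖y‖)
  yW : ℝ → E
  g₀ : ℝ
  g₀_pos : 0 < g₀
  continuousOn_yW : ContinuousOn yW (Set.Icc 0 g₀)
  norm_yW_le : ∀ g ∈ Set.Icc 0 g₀, ‖yW g‖ ≤ R
  betaOf : ℝ → ℝ
  strictAntiOn_betaOf : StrictAntiOn betaOf (Set.Ioc 0 g₀)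
  continuousOn_betaOf : ContinuousOn betaOf (Set.Ioc 0 g₀)
  κ : ℝ
  κ_pos : 0 < κ
  K : ℝ
  betaOf_sub_le : ∀ g ∈ Set.Ioc 0 g₀, |betaOf g - κ / g ^ 2| ≤ K
  c : ℝ → YMSpecies G → ℝ
  c_curvature : ∀ g : ℝ, c g r.curvature = 1
  expect : ℝ × E → ℕ → (n : ℕ) → (Fin n → YMSpecies G) →
    (Fin n → 𝓢(EuclideanSpace ℝ (Fin 4), ℝ)) → ℝ
  expect_step : ∀ (g : ℝ) (y : E), g ∈ Set.Icc 0 δ → ‖y‖ ≤ R →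
    ∀ (S n : ℕ) (σ : Fin n → YMSpecies G) (f : Fin n → 𝓢(EuclideanSpace ℝ (Fin 4), ℝ)),
      expect (φ g y, Ψ g y) S n σ f = expect (g, y) (M * S) n σ (fun i => blockDilate M (f i))
  expect_wilson : ∀ g ∈ Set.Ioc 0 g₀,
    ∀ (L n : ℕ) (σ : Fin n → YMSpecies G) (f : Fin n → 𝓢(EuclideanSpace ℝ (Fin 4), ℝ)),
      expect (g, yW g) (2 * L + 1) n σ f = wilsonCentredSchwinger r.ρ (betaOf g) L (c g) n σ f


section PreStepFacts

variable {G : Type} [Group G] [TopologicalSpace G] [IsTopologicalGroup G] [CompactSpace G]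
  [MeasurableSpace G] [BorelSpace G] {r : LatticeRep G} {M : ℕ}

/-- `PreStep` IS the weakening: every inhabitant of the crux structure gives one. [folklore] -/
def toPreStep (S : BalabanBanachStep G r M) : PreStep G r M :=
  { E := S.E, φ := S.φ, Ψ := S.Ψ, A := S.A, b := S.b, θ := S.θ, C := S.C, δ := S.δ,
    b_pos := S.b_pos, θ_nonneg := S.θ_nonneg, θ_lt_one := S.θ_lt_one, C_pos := S.C_pos,
    δ_pos := S.δ_pos, norm_A_le := S.norm_A_le, remainder := S.remainder,
    lipschitz_fibre := S.lipschitz_fibre, lipschitz_base := S.lipschitz_base, b₀ := S.b₀,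
    b_eq := S.b_eq, R := S.R, δ_le_R := S.δ_le_R, θ' := S.θ', θ'_nonneg := S.θ'_nonneg,
    θ'_lt_one := S.θ'_lt_one, contraction := S.contraction, remainder_basin := S.remainder_basin,
    yW := S.yW, g₀ := S.g₀, g₀_pos := S.g₀_pos, continuousOn_yW := S.continuousOn_yW,
    norm_yW_le := S.norm_yW_le, betaOf := S.betaOf, strictAntiOn_betaOf := S.strictAntiOn_betaOf,
    continuousOn_betaOf := S.continuousOn_betaOf, κ := S.κ, κ_pos := S.κ_pos, K := S.K,
    betaOf_sub_le := S.betaOf_sub_le, c := S.c, c_curvature := S.c_curvature, expect := S.expect,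
    expect_step := S.expect_step, expect_wilson := S.expect_wilson }

/-- `‖(1/2) • id‖ ≤ 1/2` on `ℝ × ℝ`. [folklore] -/
theorem norm_half_id_le : ‖(1 / 2 : ℝ) • ContinuousLinearMap.id ℝ (ℝ × ℝ)‖ ≤ 1 / 2 := by
  refine (norm_smul_le (1 / 2 : ℝ) (ContinuousLinearMap.id ℝ (ℝ × ℝ))).trans ?_
  have h : ‖ContinuousLinearMap.id ℝ (ℝ × ℝ)‖ ≤ 1 := ContinuousLinearMap.norm_id_le
  have : ‖(1 / 2 : ℝ)‖ = 1 / 2 := by norm_num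
  rw [this]
  linarith [norm_nonneg (ContinuousLinearMap.id ℝ (ℝ × ℝ))]

/-- `((1/2) • id) y = (1/2) • y`. [folklore] -/
theorem half_id_apply (y : ℝ × ℝ) :
    ((1 / 2 : ℝ) • ContinuousLinearMap.id ℝ (ℝ × ℝ)) y = (1 / 2 : ℝ) • y := rfl

/-- `t ↦ 1/t²` is strictly decreasing on `(0, 1]`. [folklore] -/
theorem strictAntiOn_one_div_sq : StrictAntiOn (fun t : ℝ => 1 / t ^ 2) (Set.Ioc 0 1) := by
  intro t ht t' ht' hlt
  simp only
  apply one_div_lt_one_div_of_lt (by have := ht.1; positivity)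
  exact pow_lt_pow_left₀ hlt ht.1.le two_ne_zero

/-- `t ↦ 1/t²` is continuous on `(0, 1]`. [folklore] -/
theorem continuousOn_one_div_sq : ContinuousOn (fun t : ℝ => 1 / t ^ 2) (Set.Ioc 0 1) := by
  refine continuousOn_of_forall_continuousAt fun t ht => ?_
  have : t ^ 2 ≠ 0 := by have := ht.1; positivity
  fun_prop (disch := assumption)

variable (r M)

/-- **The no-(4c) junk inhabitant : for EVERY `G`, `r` and `M ≥ 2` the
structure `BalabanBanachStep G r M` minus its continuity field is inhabited** by the chart
`ℝ × ℝ`, the exactly parabolic flow `g ↦ g + (log M) g³`, the halving fibre map, the Wilson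
embedding `yW g = (1, g)`, `betaOf g = 1/g²` and the F1-recursion functional `expectJ`, whose
(4a) holds identically and whose (4b) holds by decoding `(k, g)` from the fibre coordinate.
So ALL the content of the crux sits in (4c). [folklore] -/
def preStepJunk (hM : 2 ≤ M) : PreStep G r M where
  E := ℝ × ℝ
  φ g _ := φJ M g
  Ψ _ y := (1 / 2 : ℝ) • y
  A := (1 / 2 : ℝ) • ContinuousLinearMap.id ℝ (ℝ × ℝ)
  b := Real.log M
  θ := 1 / 2
  C := 1
  δ := 1
  b_pos := Real.log_pos (by exact_mod_cast hM)
  θ_nonneg := by norm_num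
  θ_lt_one := by norm_num
  C_pos := one_pos
  δ_pos := one_pos
  norm_A_le := norm_half_id_le
  remainder g y _ _ := by
    constructor
    · simp only [φJ, sub_self, abs_zero]; positivity
    · rw [half_id_apply, sub_self, norm_zero]; positivity
  lipschitz_fibre g y y' _ _ _ := by
    constructor
    · simp only [sub_self, abs_zero]; positivity
    · have : (1 / 2 : ℝ) • y - (1 / 2 : ℝ) • y' -
          ((1 / 2 : ℝ) • ContinuousLinearMap.id ℝ (ℝ × ℝ)) (y - y') = 0 := by
        rw [half_id_apply, smul_sub]
        abel
      rw [this, norm_zero]; positivity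
  lipschitz_base g g' y _ _ _ := by
    constructor
    · have : φJ M g - φJ M g' - (g - g') - Real.log M * (g ^ 3 - g' ^ 3) = 0 := by
        simp only [φJ]; ring
      rw [this, abs_zero]; positivity
    · simp only [sub_self, norm_zero]; positivity
  b₀ := 1
  b_eq := (one_mul _).symm
  R := 2
  δ_le_R := by norm_num
  θ' := 1 / 2
  θ'_nonneg := by norm_num
  θ'_lt_one := by norm_num
  contraction g y y' _ _ _ := by
    rw [← smul_sub, norm_smul]; norm_num
  remainder_basin g y _ _ := by simp only [φJ, sub_self, abs_zero]; positivity
  yW g := ((1 : ℝ), g)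
  g₀ := 1
  g₀_pos := one_pos
  continuousOn_yW := by fun_prop
  norm_yW_le g hg := by
    rw [Prod.norm_def, Real.norm_eq_abs, Real.norm_eq_abs, abs_one, abs_of_nonneg hg.1]
    exact max_le (by norm_num) (hg.2.trans (by norm_num))
  betaOf g := 1 / g ^ 2
  strictAntiOn_betaOf := strictAntiOn_one_div_sq
  continuousOn_betaOf := continuousOn_one_div_sq
  κ := 1
  κ_pos := one_pos
  K := 0
  betaOf_sub_le g _ := by simp
  c _ _ := 1
  c_curvature _ := rfl
  expect p S n σ f := expectJ r M hM n σ p S f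
  expect_step g y _ _ S n σ f := expectJ_step r M hM n σ (g, y) S f
  expect_wilson g hg L n σ f := expectJ_wilson r M hM n σ hg L f

/-- **Theorem A.** `PreStep G r M` (the crux structure without (4c)) is inhabited for every
`G`, `r`, `M ≥ 2`: the typed crux minus continuity is TRIVIALLY TRUE; any proof or disproof of
`BalabanStepParabolic` is about `continuousOn_expect` alone. [folklore] -/
theorem preStep_nonempty (hM : 2 ≤ M) : Nonempty (PreStep G r M) := ⟨preStepJunk r M hM⟩

end PreStepFacts

end

end Summit.QuantumFields.YangMills.Theorems.BalabanStepParabolic.Negative
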